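import Literature.NumberTheory.EllipticCurves.CuspFormLFunctionLevelConductorOfCarayolProofs
import Literature.NumberTheory.EllipticCurves.NewformGaloisRepEulerFactors
import Literature.NumberTheory.EllipticCurves.TateModuleTwistNewformEulerFactorsProofs
import Literature.NumberTheory.EllipticCurves.HasseWeilAbelianEulerFactorForallProofs
import Literature.NumberTheory.EllipticCurves.EisensteinNewformLevelRaising
import Literature.NumberTheory.EllipticCurves.OrdinaryReductionTateModule
import Literature.NumberTheory.EllipticCurves.DeligneHeckeEigenvalueBound
import Literature.NumberTheory.EllipticCurves.HeckeEigenvalueSupNormStrictProofs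
import Literature.NumberTheory.EllipticCurves.LutzNagellGeneralWeierstrass
import Literature.NumberTheory.EllipticCurves.GlobalMinimalModelProofs
import Literature.NumberTheory.EllipticCurves.SzpiroFreyProofs
import Literature.NumberTheory.DiophantineGeometry.GeneralizedFermatTwoPowerCoefficientFreyProofs
import Literature.NumberTheory.Automorphic.CDTTheorem722
import Literature.NumberTheory.Automorphic.BCDTModularity
import HarnessLib

/-!
# stub-ideation k3 (gen 7, FAMILY 3 — probe the extremes) for `stub_threeImpTwo` (S9) of crux
`FreyModularity` (stmt-ABC-11340), line `Sketch` — companion to `STUB-IDEAS-stub_threeImpTwo-3.md`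

Gen 6 (k2 ⊕ k3) closed every glue arrow of S9 modulo {`SomeLevelPacket` (= the `ℓ`-HOLE of the single-prime
hypothesis `W.IsModularGaloisRepTate ℓ`: the packet newform `f₀` is known to match `a_p(W)` only OFF `N ℓ`),
Carayol (A), Saito at `2`, `CarayolSteinbergGamma0`}.  Gen 7 k3 probes the hole itself AT THE EXTREMES of the
local structure at `ℓ = p`:

* §0  the HOLED packet (k2 M0, PROVED) vs the FULL packet; the two trivial hole-closers (`ℓ ∣ N`; `a_ℓ` match).
* §1  EXTREMAL INSTANCE TABLE for the route's three call sites (I1 Frey at `3`, I2 the switched curve `W′` at `3`,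
      I3 Frey case B at `5`): E1 Frey good at `3` ⇒ `a_3 = 0` (full `2`-torsion: `4 ∣ #Ẽ(𝔽₃) ∈ (0, 7]`);
      E2 Frey good at `5` ⇒ `a_5 = ±2` (ordinary); E3/E4 `W′[5] ≅ E[5]`, `E` multiplicative at `3`, `W′` good at `3`
      ⇒ `a_3(W′) ≡ ±4 (mod 5)` ⇒ `a_3(W′) = ±1` (ordinary).  HENCE the only GOOD-SUPERSINGULAR configuration at
      `ℓ = p` on the route is {Frey, `3 ∤ abc`} at `ℓ = 3`, where `a_3(E) = 0`.
* §2  REGIME ROAD (realisation-free: no `DeligneHeckeRep`, no second prime) for `W` semistable at `ℓ`: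
      {unit / non-unit `a_ℓ(f₀)`} × {good ordinary, good supersingular, multiplicative} —
      unit ∧ ordinary ⇒ `a_ℓ(f₀) = a_ℓ(W)` (N1 Hida 3.26(2) unit root + N3o étale quotient + H1 χ-line uniqueness);
      unit ∧ multiplicative ⇒ `a_ℓ(f₀) = ±(ℓ + 1)`, the EISENSTEIN eigenvalue, excluded on `S₂(Γ₀(N))` by the
      tree's PROVED strict Hecke bound `norm_lt_of_hasEigenvalue_heckeT_weight_two` (N1 + N3m, NO Deligne);
      unit ∧ supersingular ⇒ ⊥ (N1 residual frame vs Serre Prop. 12, PROVED `hasLevelTwoInertiaShape…`);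
      non-unit ∧ (ordinary ∨ multiplicative) ⇒ ⊥ (N2 Fontaine / Edixhoven Thm 2.6: local irreducibility);
      non-unit ∧ supersingular ∧ `ℓ ≥ 5` ⇒ `a_ℓ(f₀) = 0 = a_ℓ(W)` (integrality + Deligne N4 + Hasse squeeze).
      The ONLY configuration no local extreme decides: `ℓ ∈ {2, 3}`, good supersingular, non-unit —
      `a_3 ∈ {0, ±3}` on both sides (crystalline-trace comparison = Eichler–Shimura at `p`): typed §3.
* §3  the residual `FreyThreeSupersingularResidual` and the closers.

Leaves: N1 `Hida2000_thm326_ordinary_unitRoot` (tree, typed, unproved), N2 `Newform1NonUnitLocallyIrreducible`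
(NEW, typed here), N3o `OrdinaryEtaleQuotientUnitRoot` (NEW, M: unit-root clause on the PROVED Greenberg character
`ordinaryReduction_exists_unramified_character_mod_kernelReduction_holds`), N3m `TateFiltrationAtP` (NEW, M/L: the
tree's `exists_tateBasis_localPoints_of_hasMultiplicativeReductionAt` at `v ∣ p`), N4
`Deligne1974_heckeT_eigenvalue_norm_le` (tree; needed ONLY off the route's call sites).
[cite: Hida2000, Thm. 3.26 (2)] [cite: Wiles1988, Thm. 2.1.4] [cite: Edixhoven1992, Thms. 2.5–2.6]
[cite: GreenbergLNM1716, §2 p. 76] [cite: DarmonDiamondTaylor1995, Prop. 2.12, Thm. 3.1 (e)]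
[cite: SilvermanATAEC1994, Thm. V.5.3] [cite: SerreInventiones1972, §1.11 Prop. 11, §1.12 Prop. 12]
[cite: DiamondShurman2005, Prop. 5.2.1, Prop. 9.6.4] [cite: Deligne1974, Thm. 8.2] [cite: Saito1997, Thm.]
-/

set_option linter.dupNamespace false

noncomputable section

open scoped NumberField Polynomial MatrixGroups ModularForm
open NumberField IsDedekindDomain Field Polynomial Matrix Rat.HeightOneSpectrum CongruenceSubgroup
  Literature.NumberTheory.GaloisRepresentations Literature.NumberTheory.EllipticCurves
  Literature.NumberTheory.EllipticCurves.ModularForms Literature.NumberTheory.Automorphic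
  WeierstrassCurve

namespace Summit.ABC.ABC.Cruxes.FreyModularity.Sketch.ThreeImpTwoIdeas3g7

/-! ## §0 The holed packet (k2 gen-5 M0, PROVED) and the full packet (gen-6 `SomeLevelPacket`) -/

section Packets

variable (W : WeierstrassCurve ℚ) [W.IsElliptic] (ℓ : ℕ) {N : ℕ} [NeZero N] (f₀ : CuspForm (Gamma0 N) 2)

/-- The HOLED packet: what `W.IsModularGaloisRepTate ℓ` gives (k2 M0
`exists_isNewform0_hasGoodReductionAt_of_isModularGaloisRepTate`, 2g6 :620, PROVED): a newform `f₀` on `Γ₀(N)`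
with `W` good off `N ℓ` and `a_p(f₀) = a_p(W)` for `p ∤ N ℓ`. [cite: DiamondShurman2005, Prop. 9.6.4] -/
def HoledPacket : Prop :=
  IsNewform0 f₀ ∧
    (∀ v : HeightOneSpectrum (𝓞 ℚ), ¬ ((primesEquiv v : ℕ) ∣ N * ℓ) → W.HasGoodReductionAt v) ∧
    ∀ p : ℕ, p.Prime → ¬ p ∣ N * ℓ → cuspCoeff f₀ p = (W.LFunction p : ℂ)

omit [W.IsElliptic] in
/-- The FULL packet (gen-6 `SomeLevelPacket`, pointwise): good off `N`, `a_p` match off `N`. [folklore] -/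
def FullPacket : Prop :=
  IsNewform0 f₀ ∧
    (∀ v : HeightOneSpectrum (𝓞 ℚ), ¬ ((primesEquiv v : ℕ) ∣ N) → W.HasGoodReductionAt v) ∧
    ∀ p : ℕ, p.Prime → ¬ p ∣ N → cuspCoeff f₀ p = (W.LFunction p : ℂ)

/-- `SomeLevelPacket` for ONE pair `(W, ℓ)` (gen-6 k3 `SomeLevelPacket` = `∀ W ℓ, SomeLevelPacketFor W ℓ`). -/
def SomeLevelPacketFor [Fact ℓ.Prime] : Prop :=
  W.IsModularGaloisRepTate ℓ → ∃ (N : ℕ) (_ : NeZero N) (f₀ : CuspForm (Gamma0 N) 2), FullPacket W f₀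

variable {W ℓ f₀}

omit [W.IsElliptic] in
/-- **Hole-closer 0a (PROVED): if `ℓ ∣ N` there is no hole.** [folklore] -/
theorem fullPacket_of_holedPacket_of_dvd [Fact ℓ.Prime] (hℓN : ℓ ∣ N) (h : HoledPacket W ℓ f₀) :
    FullPacket W f₀ := by
  obtain ⟨hf₀, hgood, hap⟩ := h
  have key : ∀ p : ℕ, p.Prime → ¬ p ∣ N → ¬ p ∣ N * ℓ := by
    intro p hp hpN hpNℓ
    rcases (Nat.Prime.dvd_mul hp).mp hpNℓ with h | h
    · exact hpN h
    · exact hpN (((Nat.prime_dvd_prime_iff_eq hp Fact.out).mp h) ▸ hℓN)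
  refine ⟨hf₀, fun v hv ↦ hgood v (key _ (primesEquiv v).2 hv), fun p hp hpN ↦ hap p hp (key p hp hpN)⟩

omit [W.IsElliptic] in
/-- **Hole-closer 0b (PROVED): good reduction at `ℓ` + the single coefficient `a_ℓ(f₀) = a_ℓ(W)` fill
the hole.** [folklore] -/
theorem fullPacket_of_holedPacket_of_coeff [Fact ℓ.Prime]
    (hgoodℓ : ∀ v : HeightOneSpectrum (𝓞 ℚ), (primesEquiv v : ℕ) = ℓ → W.HasGoodReductionAt v)
    (ha : cuspCoeff f₀ ℓ = (W.LFunction ℓ : ℂ)) (h : HoledPacket W ℓ f₀) : FullPacket W f₀ := by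
  obtain ⟨hf₀, hgood, hap⟩ := h
  have key : ∀ p : ℕ, p.Prime → ¬ p ∣ N → p ≠ ℓ → ¬ p ∣ N * ℓ := by
    intro p hp hpN hpℓ hpNℓ
    rcases (Nat.Prime.dvd_mul hp).mp hpNℓ with h | h
    · exact hpN h
    · exact hpℓ ((Nat.prime_dvd_prime_iff_eq hp Fact.out).mp h)
  refine ⟨hf₀, fun v hv ↦ ?_, fun p hp hpN ↦ ?_⟩
  · by_cases hvℓ : (primesEquiv v : ℕ) = ℓ
    · exact hgoodℓ v hvℓ
    · exact hgood v (key _ (primesEquiv v).2 hv hvℓ)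
  · by_cases hpℓ : p = ℓ
    · subst hpℓ; exact ha
    · exact hap p hp (key p hp hpN hpℓ)

end Packets

/-! ## §1 Extremal instance table (FAMILY 3): residue types at `ℓ = p` for the three call sites -/

section Extremes

/-- **E1-core (PROVED).** `4 ∣ c`, `|4 - c| ≤ 3` (Hasse at `p = 3`: `|a_3| ≤ 2√3 < 4`) ⇒ `c = 4`, `a_3 = 0`.
[folklore] -/
theorem sub_eq_zero_of_four_dvd_of_abs_le {c : ℕ} (h4 : 4 ∣ c) (hH : |(4 : ℤ) - c| ≤ 3) :
    (4 : ℤ) - c = 0 := by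
  obtain ⟨k, rfl⟩ := h4
  rw [abs_le] at hH
  push_cast at hH ⊢
  omega

/-- **E2-core (PROVED).** `4 ∣ c`, `|6 - c| ≤ 4` (Hasse at `p = 5`: `|a_5| ≤ 2√5 < 5`) ⇒ `a_5 = 6 - c = ±2`,
in particular `5 ∤ a_5` (ORDINARY). [folklore] -/
theorem not_five_dvd_of_four_dvd_of_abs_le {c : ℕ} (h4 : 4 ∣ c) (hH : |(6 : ℤ) - c| ≤ 4) :
    ¬ (5 : ℤ) ∣ (6 : ℤ) - c := by
  obtain ⟨k, rfl⟩ := h4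
  rw [abs_le] at hH
  push_cast at hH ⊢
  omega

/-- **E4-core (PROVED).** `|a| ≤ 3` and `a ≡ ±4 (mod 5)` ⇒ `a = ∓1`; in particular `3 ∤ a` (ORDINARY at `3`).
[folklore] -/
theorem not_three_dvd_of_abs_le_three_of_emod_five {a : ℤ} (h : |a| ≤ 3)
    (h5 : a % 5 = 4 ∨ a % 5 = 1) : ¬ (3 : ℤ) ∣ a := by
  rw [abs_le] at h
  omega

/-- **E1.** A GLOBALLY MINIMAL model `W₀ = C • E_(A,B)` of a Frey–Hellegouarch curve with good reduction at `3`
has `a_3(W₀) = 0` — SUPERSINGULAR at `3`: `4 ∣ #E(ℚ)_tors` (liftFive-3g4 B3 `four_dvd_torsionOrder_freyCurve`,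
PROVED) `= #W₀(ℚ)_tors ∣ #W̃₀(𝔽₃)` (`torsionOrder_variableChange_holds`,
`LutzNagellGeneral.torsionOrder_dvd_reductionPointCount`), Hasse (`hasse_bound_holds`) and E1-core.  Size S.
[cite: Knapp1993, Thm. 5.1(c)] [cite: SilvermanAEC2009, Thm. V.1.1] -/
theorem frobeniusTrace_three_eq_zero_of_freyCurve {A B : ℤ} (hAB : IsCoprime A B) (h0 : A * B * (A + B) ≠ 0)
    (C : VariableChange ℚ) [(C • freyCurve A B).IsElliptic] [(C • freyCurve A B).IsGloballyMinimal]
    [Fact (Nat.Prime 3)] (hgood : (C • freyCurve A B).HasGoodReductionAtPrime 3) :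
    (C • freyCurve A B).frobeniusTrace 3 = 0 := by
  sorry

/-- **E1′ (place / `L`-function form, the form the packet consumes).**  `3 ∤ ab(a+b)` ⇒ `a_3(E_(a,b)) = 0`.
Size S (E1 + `frobeniusTraceAt_eq_frobeniusTrace` + the `LFunction`-at-good-`p` dictionary). [cite: Knapp1993, Thm. 5.1(c)] -/
theorem lFunction_three_freyCurve_eq_zero {a b : ℤ} (hab : IsCoprime a b) (h0 : a * b * (a + b) ≠ 0)
    (h3 : ¬ (3 : ℤ) ∣ a * b * (a + b)) : (freyCurve a b).LFunction 3 = 0 := by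
  sorry

/-- **E2.** A globally minimal model of a Frey curve with good reduction at `5` has `5 ∤ a_5` (`a_5 = ±2`):
ORDINARY at `5`.  (So at `ℓ = 5` a Frey curve is never good-supersingular; in case B it is multiplicative by
liftFive-3g4 `five_dvd_and_hasMultiplicativeReductionAt_five_of_caseB`.)  Size S. [cite: Knapp1993, Thm. 5.1(c)] -/
theorem not_five_dvd_frobeniusTrace_five_of_freyCurve {A B : ℤ} (hAB : IsCoprime A B)
    (h0 : A * B * (A + B) ≠ 0) (C : VariableChange ℚ) [(C • freyCurve A B).IsElliptic]
    [(C • freyCurve A B).IsGloballyMinimal] [Fact (Nat.Prime 5)]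
    (hgood : (C • freyCurve A B).HasGoodReductionAtPrime 5) :
    ¬ (5 : ℤ) ∣ (C • freyCurve A B).frobeniusTrace 5 := by
  sorry

/-- **E4 (call site I2).**  If `W′[5] ≅ E[5]` (a common framed model `ρ`), `E` has multiplicative reduction at
the place `v = 3` and `W′` has good reduction at `v`, then `3 ∤ a_3(W′)` — `W′` is ORDINARY at `3`, never
supersingular: by Tate (`exists_tateBasis_geomTorsion_of_hasMultiplicativeReductionAt`, `5 ≠ 3`, and
`serreTate_frobenius_smul_torsion_…_holds`) `E[5]|_{D_3}` has Frobenius eigenvalues `{3δ, δ}`, `δ = ±1`, so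
`a_3(W′) ≡ tr ρ(Frob_3) ≡ ±4 (mod 5)`; Hasse `|a_3(W′)| ≤ 3`; E4-core.  (If `E[5]` is ramified at `3` the
hypothesis `W′` good at `3` is absurd by Néron–Ogg–Shafarevich, so the statement still holds.)  Size M.
[cite: DarmonDiamondTaylor1995, Prop. 2.12 (b)] [cite: SilvermanATAEC1994, Thm. V.5.3] -/
theorem not_three_dvd_frobeniusTraceAt_of_torsion_five_of_mult (W' E : WeierstrassCurve ℚ) [W'.IsElliptic]
    [E.IsElliptic] [Fact (Nat.Prime 5)] (ρ : ModPGaloisRep ℚ (ZMod 5) 2) (hW : W'.IsTorsionGaloisRep 5 ρ)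
    (hE : E.IsTorsionGaloisRep 5 ρ) (v : HeightOneSpectrum (𝓞 ℚ)) (hv : (primesEquiv v : ℕ) = 3)
    (hEm : E.HasMultiplicativeReductionAt v) (hWg : W'.HasGoodReductionAt v) :
    ¬ (3 : ℤ) ∣ W'.frobeniusTraceAt v := by
  sorry

end Extremes

/-! ## §2 The regime road at `ℓ = p` (realisation-free), its leaves N2/N3o/N3m, helpers H1–H6 -/

section Leaves

/-- **N2 — `Newform1NonUnitLocallyIrreducible` (Fontaine 1979; Edixhoven 1992 Thm. 2.6; Breuil / Berger–Li–Zhu).**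
For a newform `g` of weight `2` on `Γ₁(N)`, a prime `p ∤ N`, `ι : ℚ̄_p ≃ ℂ` with `ι⁻¹(a_p(g))` a NON-unit, and an
irreducible `ρ` attached to `g` away from `N p`: `ρ|_{Γ_{ℚ_w}}` (`w ∣ p`) has NO stable line — in the matrix
vocabulary of N1 (`Hida2000_thm326_ordinary_unitRoot`): no frame `Q` with `(Q⁻¹ ρ(σ) Q)₁₀ = 0` for all
`σ ∈ Γ_{ℚ_w}`.  (Printed residually: `ρ̄|_{I_p} ≅ ψ₂ ⊕ ψ₂^p`, level-2 fundamental characters, irreducible over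
`𝔽_p`; `p`-adically: a crystalline `2`-dimensional representation with Hodge–Tate weights `{0,1}` and
`v(a_p) > 0` is irreducible, by weak admissibility.)  NEW leaf, XL to port (rests on the crystalline comparison
for modular forms), catalogued-grade to name. [cite: Edixhoven1992, Thm. 2.6] [cite: Wiles1988, §2.1] -/
def Newform1NonUnitLocallyIrreducible : Prop :=
  ∀ {N : ℕ} [NeZero N] (g : CuspForm (CongruenceSubgroup.Gamma1 N) 2), IsNewform1 g →
    ∀ (p : ℕ) [Fact p.Prime] (ι : PadicAlgCl p ≃+* ℂ), ¬ p ∣ N →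
    Valued.v (ι.symm ((UpperHalfPlane.qExpansion 1 ⇑g).coeff p)) < 1 →
    ∀ ρ : FramedGaloisRep ℚ (PadicAlgCl p) 2,
      IsGaloisRepOfNewform1 g ((ι.symm : ℂ →+* PadicAlgCl p).comp (algebraMap (coeffCharField g) ℂ))
        {q | q ∣ N * p} ρ → ρ.toGaloisRep.IsIrreducible →
    ∀ w : HeightOneSpectrum (𝓞 ℚ), (p : 𝓞 ℚ) ∈ w.asIdeal →
      ¬ ∃ Q : GL (Fin 2) (PadicAlgCl p), ∀ σ, (Q⁻¹ * ρ.toLocal w σ * Q).val 1 0 = 0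

/-- **N3o — `OrdinaryEtaleQuotientUnitRoot` (Greenberg LNM 1716 §2, p. 76: "the action on `Ẽ[p^∞]` is by a
character `φ` … `φ(Frob_v) = α_v`"; Serre 1972 §1.11; Silverman V.2.3.1 `π² − aπ + q = 0`).**  At a place `v ∣ p` of
good ORDINARY reduction, on top of the PROVED filtration `ellipticOrdinaryReduction_tateModule_filtration_holds`
(line `L`, inertia `χ_p` on `L`, trivial on `V/L`): every absolute arithmetic Frobenius `σ ∈ Γ_{ℚ_v}` acts on
`V_pW / L` by the UNIT ROOT `u ∈ ℤ_pˣ` of `X² − a_v X + p`.  NEW leaf, size M (the unit-root clause missing from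
the PROVED `ordinaryReduction_exists_unramified_character_mod_kernelReduction_holds`). [cite: GreenbergLNM1716, §2 p. 76]
[cite: SerreInventiones1972, §1.11 Prop. 11 Cor.] [cite: SilvermanAEC2009, Thm. V.2.3.1(b)] -/
def OrdinaryEtaleQuotientUnitRoot : Prop :=
  ∀ (W : WeierstrassCurve ℚ) [W.IsElliptic] (p : ℕ) [Fact p.Prime] (v : HeightOneSpectrum (𝓞 ℚ)),
    (p : 𝓞 ℚ) ∈ v.asIdeal → W.HasGoodReductionAt v → ¬ ((p : ℤ) ∣ W.frobeniusTraceAt v) →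
    ∃ L : Submodule ℚ_[p] (W.rationalTateModule p),
      Module.finrank ℚ_[p] L = 1 ∧
      (∀ (τ : absoluteGaloisGroup (v.adicCompletion ℚ)), ∀ x ∈ L,
        W.rationalGaloisRepTate p (absGaloisRestrict ℚ (v.adicCompletion ℚ) τ) x ∈ L) ∧
      (∀ τ ∈ absInertia (v.adicCompletion ℚ), ∀ x ∈ L,
        W.rationalGaloisRepTate p (absGaloisRestrict ℚ (v.adicCompletion ℚ) τ) x =
          (((GaloisRep.cyclotomicCharacter (v.adicCompletion ℚ) p τ : ℤ_[p]ˣ) : ℤ_[p]) : ℚ_[p]) • x) ∧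
      ∃ u : ℤ_[p], IsUnit u ∧
        (u : ℚ_[p]) ^ 2 - (W.frobeniusTraceAt v : ℚ_[p]) * u + p = 0 ∧
        ∀ σ : absoluteGaloisGroup (v.adicCompletion ℚ), IsAbsArithFrob σ →
          ∀ x : W.rationalTateModule p,
            W.rationalGaloisRepTate p (absGaloisRestrict ℚ (v.adicCompletion ℚ) σ) x - (u : ℚ_[p]) • x ∈ L

/-- **N3m — `TateFiltrationAtP` (Tate's uniformisation AT the residue characteristic; DDT Prop. 2.12 (a),
Silverman ATAEC Thm. V.5.3 / Ex. 5.13).**  At a place `v ∣ p` of MULTIPLICATIVE reduction: a `Γ_{ℚ_v}`-stable line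
`L ⊂ V_pW` with inertia acting by `χ_p` on `L` and trivially on `V/L`, and every element of `Γ_{ℚ_v}` acting on
`V/L` by `δ(σ) = +1` (split) / by the unramified quadratic character (non-split: arithmetic Frobenius acts by
`-1`).  The tree has exactly this at `v ∤ p` (`exists_tateBasis_localPoints_of_hasMultiplicativeReductionAt`,
hypothesis `hpv : p ∉ v`); NEW leaf = the same at `v ∣ p`, size M/L. [cite: DarmonDiamondTaylor1995, Prop. 2.12]
[cite: SilvermanATAEC1994, Thm. V.5.3, Exercise 5.13] -/
def TateFiltrationAtP : Prop :=
  ∀ (W : WeierstrassCurve ℚ) [W.IsElliptic] (p : ℕ) [Fact p.Prime] (v : HeightOneSpectrum (𝓞 ℚ)),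
    (p : 𝓞 ℚ) ∈ v.asIdeal → W.HasMultiplicativeReductionAt v →
    ∃ L : Submodule ℚ_[p] (W.rationalTateModule p),
      Module.finrank ℚ_[p] L = 1 ∧
      (∀ (τ : absoluteGaloisGroup (v.adicCompletion ℚ)), ∀ x ∈ L,
        W.rationalGaloisRepTate p (absGaloisRestrict ℚ (v.adicCompletion ℚ) τ) x ∈ L) ∧
      (∀ τ ∈ absInertia (v.adicCompletion ℚ), ∀ x ∈ L,
        W.rationalGaloisRepTate p (absGaloisRestrict ℚ (v.adicCompletion ℚ) τ) x =
          (((GaloisRep.cyclotomicCharacter (v.adicCompletion ℚ) p τ : ℤ_[p]ˣ) : ℤ_[p]) : ℚ_[p]) • x) ∧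
      (∀ τ ∈ absInertia (v.adicCompletion ℚ), ∀ x : W.rationalTateModule p,
        W.rationalGaloisRepTate p (absGaloisRestrict ℚ (v.adicCompletion ℚ) τ) x - x ∈ L) ∧
      (W.HasSplitMultiplicativeReductionAt v → ∀ (σ : absoluteGaloisGroup (v.adicCompletion ℚ))
        (x : W.rationalTateModule p), W.rationalGaloisRepTate p (absGaloisRestrict ℚ (v.adicCompletion ℚ) σ) x - x ∈ L) ∧
      (¬ W.HasSplitMultiplicativeReductionAt v → ∀ σ : absoluteGaloisGroup (v.adicCompletion ℚ), IsAbsArithFrob σ →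
        ∀ x : W.rationalTateModule p, W.rationalGaloisRepTate p (absGaloisRestrict ℚ (v.adicCompletion ℚ) σ) x + x ∈ L)

end Leaves

section Helpers

/-- **H1 — χ-line uniqueness (PROVED, pure linear algebra).**  Two lines `L₁, L₂` in a vector space; an
endomorphism `g` acting on `L₂` by a scalar `c ≠ 1` and trivially on `V/L₁` ⇒ `L₁ = L₂`.  (Applied with `g` = an
inertia element, `c = χ_p(g) ≠ 1`: the Hida frame's line, the curve filtration's line and the Tate line coincide,
so the unramified QUOTIENT characters agree.) [folklore] -/
theorem line_eq_of_scalar_of_trivial_quotient {F V : Type*} [Field F] [AddCommGroup V] [Module F V]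
    (L₁ L₂ : Submodule F V) (h₁ : Module.finrank F L₁ = 1) (h₂ : Module.finrank F L₂ = 1)
    (g : V →ₗ[F] V) (c : F) (hc : c ≠ 1) (hL₂ : ∀ x ∈ L₂, g x = c • x) (hq : ∀ x, g x - x ∈ L₁) :
    L₁ = L₂ := by
  have hle : L₂ ≤ L₁ := by
    intro x hx
    have h := hq x
    rw [hL₂ x hx] at h
    have h' : (c - 1) • x ∈ L₁ := by rw [sub_smul, one_smul]; exact h
    exact (Submodule.smul_mem_iff L₁ (sub_ne_zero.mpr hc)).mp h'
  haveI : FiniteDimensional F L₁ := Module.finite_of_finrank_pos (by omega)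
  exact (Submodule.eq_of_le_of_finrank_eq hle (by rw [h₁, h₂])).symm

/-- **H3-core (PROVED).**  The multiplicative extreme IS the Eisenstein eigenvalue: a root `α = ±1` of
`X² − a X + ℓ` forces `a = ±(ℓ + 1)`. [folklore] -/
theorem eq_or_eq_neg_of_root_one {R : Type*} [CommRing R] [NoZeroDivisors R] (a ℓ α : R)
    (hα : α = 1 ∨ α = -1) (h : α ^ 2 - a * α + ℓ = 0) : a = ℓ + 1 ∨ a = -(ℓ + 1) := by
  rcases hα with rfl | rfl
  · left; linear_combination -h
  · right; linear_combination h

/-- **H3-bound (PROVED pointer).**  `‖±(ℓ+1)‖ = ℓ + 1` is NOT `< ℓ + 1`: the tree's UNCONDITIONAL strict Hecke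
bound `norm_lt_of_hasEigenvalue_heckeT_weight_two` (sup-norm argument, DS Prop. 5.2.1) excludes it — no Deligne.
[cite: DiamondShurman2005, Prop. 5.2.1] -/
theorem not_hasEigenvalue_of_norm_eq {N : ℕ} [NeZero N] {ℓ : ℕ} [NeZero ℓ] (hℓ : ℓ.Prime) (hℓN : ¬ ℓ ∣ N)
    {μ : ℂ} (hμ : ‖μ‖ = (ℓ : ℝ) + 1) :
    ¬ Module.End.HasEigenvalue (ModularForms.heckeT (Gamma0 N) (2 : ℤ) ℓ) μ := by
  intro h
  have hlt : ‖μ‖ < (ℓ : ℝ) + 1 :=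
    ModularForms.norm_lt_of_hasEigenvalue_heckeT_weight_two (N := N) (p := ℓ) hℓ hℓN h
  rw [hμ] at hlt
  exact lt_irrefl _ hlt

/-- **H6-core (PROVED).**  The supersingular squeeze at `ℓ ≥ 5`: `ℓ ∣ a` and `|a| ≤ 2√ℓ` ⇒ `a = 0`
(`ℓ > 2√ℓ ⇔ ℓ > 4`).  At `ℓ = 3`: `a ∈ {0, ±3}` survives — the residual of §3. [folklore] -/
theorem eq_zero_of_dvd_of_abs_le_two_sqrt {ℓ : ℕ} (h5 : 5 ≤ ℓ) {a : ℤ} (hd : (ℓ : ℤ) ∣ a)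
    (ha : |(a : ℝ)| ≤ 2 * Real.sqrt ℓ) : a = 0 := by
  by_contra hne
  obtain ⟨k, rfl⟩ := hd
  have hk : k ≠ 0 := by rintro rfl; simp at hne
  have hk1 : (1 : ℝ) ≤ |(k : ℝ)| := by
    rw [← Int.cast_abs]; exact_mod_cast Int.one_le_abs hk
  have hℓ0 : (0 : ℝ) ≤ ℓ := Nat.cast_nonneg ℓ
  have hℓ5 : (5 : ℝ) ≤ ℓ := by exact_mod_cast h5
  have hsq : Real.sqrt ℓ ^ 2 = ℓ := Real.sq_sqrt hℓ0
  have hs0 : 0 ≤ Real.sqrt ℓ := Real.sqrt_nonneg ℓ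
  have habs : (ℓ : ℝ) ≤ |((ℓ * k : ℤ) : ℝ)| := by
    push_cast
    rw [abs_mul, Nat.abs_cast]
    nlinarith
  have h1 : (ℓ : ℝ) ≤ 2 * Real.sqrt ℓ := habs.trans ha
  nlinarith

variable (W : WeierstrassCurve ℚ) [W.IsElliptic] (ℓ : ℕ) [Fact ℓ.Prime] {N : ℕ} [NeZero N]
  (f₀ : CuspForm (Gamma0 N) 2)

/-- **H2 — unit ∧ good ORDINARY ⇒ the hole coefficient matches.**  Realise the `Γ₁(N)`-lift of `f₀` on
`V_ℓW ⊗ ℚ̄_ℓ` away from `N ℓ` (gen-6 k3 L0a′ `isGaloisRepOfNewform1_baseChange_of_packet` / k2 R, PROVED — the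
holed packet suffices since `ℓ ∈ {q ∣ N ℓ}` anyway), apply N1 (`Hida2000_thm326_ordinary_unitRoot`: frame with
unramified quotient `δ`, `δ(Frob) = α`, `α` the unit root of `X² − ι⁻¹(a_ℓ(f₀))X + ℓ`, nebentypus trivial by
`nebentypus_liftToGamma1_holds`), N3o (curve: quotient Frobenius `= u_W`), H1 (the two lines coincide, inertia
element with `χ(τ) ≠ 1`), hence `α = u_W` and `ι⁻¹(a_ℓ(f₀)) = α + ℓ/α = a_ℓ(W)`.  Size L (one strong cycle; all
plumbing exists in gen-6 companions). [cite: Hida2000, Thm. 3.26 (2)] [cite: GreenbergLNM1716, §2 p. 76] -/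
theorem cuspCoeff_eq_lFunction_of_unit_of_ordinary (hN1 : Hida2000_thm326_ordinary_unitRoot)
    (hN3o : OrdinaryEtaleQuotientUnitRoot) (hPk : HoledPacket W ℓ f₀) (hℓN : ¬ ℓ ∣ N)
    (ι : PadicAlgCl ℓ ≃+* ℂ) (hunit : Valued.v (ι.symm (cuspCoeff f₀ ℓ)) = 1)
    (v : HeightOneSpectrum (𝓞 ℚ)) (hv : (ℓ : 𝓞 ℚ) ∈ v.asIdeal) (hgood : W.HasGoodReductionAt v)
    (hord : ¬ ((ℓ : ℤ) ∣ W.frobeniusTraceAt v)) : cuspCoeff f₀ ℓ = (W.LFunction ℓ : ℂ) := by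
  sorry

/-- **H3 — unit ∧ MULTIPLICATIVE at `ℓ ∤ N` is impossible** (so in fact `ℓ ∣ N` and closer 0a applies): N1 + N3m +
H1 give `α = δ_W(Frob_ℓ) = ±1`, H3-core gives `a_ℓ(f₀) = ±(ℓ + 1)`, and `a_ℓ(f₀)` is an eigenvalue of `T_ℓ` on
`S₂(Γ₀(N))` (`IsNewform0`), contradicting H3-bound (PROVED strict Hecke bound).  Size L.
[cite: Hida2000, Thm. 3.26 (2)] [cite: DarmonDiamondTaylor1995, Prop. 2.12] [cite: DiamondShurman2005, Prop. 5.2.1] -/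
theorem false_of_unit_of_hasMultiplicativeReductionAt (hN1 : Hida2000_thm326_ordinary_unitRoot)
    (hN3m : TateFiltrationAtP) (hPk : HoledPacket W ℓ f₀) (hℓN : ¬ ℓ ∣ N)
    (ι : PadicAlgCl ℓ ≃+* ℂ) (hunit : Valued.v (ι.symm (cuspCoeff f₀ ℓ)) = 1)
    (v : HeightOneSpectrum (𝓞 ℚ)) (hv : (ℓ : 𝓞 ℚ) ∈ v.asIdeal) (hmult : W.HasMultiplicativeReductionAt v) :
    False := by
  sorry

/-- **H4 — unit ∧ good SUPERSINGULAR is impossible.**  N1's residual frame (tree: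
`Hida2000_thm326_ordinary_unitRoot.exists_residualFrame`: `ρ̄|_{Γ_{ℚ_w}}` ordinary, inertia characters `{ω, 1}`)
against Serre Prop. 12 (tree, PROVED: `hasLevelTwoInertiaShape_restrictField_of_dvd_frobeniusTraceAt` — `W[ℓ]|_I`
has characters `{ψ₂, ψ₂^ℓ}`): compare the characteristic polynomial of one tame-inertia generator (lattice-free).
Size M/L. [cite: SerreInventiones1972, §1.12 Prop. 12] [cite: Hida2000, Thm. 3.26 (2)] -/
theorem false_of_unit_of_supersingular (hN1 : Hida2000_thm326_ordinary_unitRoot) (hPk : HoledPacket W ℓ f₀)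
    (hℓN : ¬ ℓ ∣ N) (ι : PadicAlgCl ℓ ≃+* ℂ) (hunit : Valued.v (ι.symm (cuspCoeff f₀ ℓ)) = 1)
    (v : HeightOneSpectrum (𝓞 ℚ)) (hv : (ℓ : 𝓞 ℚ) ∈ v.asIdeal) (hgood : W.HasGoodReductionAt v)
    (hss : (ℓ : ℤ) ∣ W.frobeniusTraceAt v) : False := by
  sorry

/-- **H5o — non-unit ∧ good ORDINARY is impossible**: the PROVED curve filtration, transported through the frame
(k2 R / k3 L0a′), is a stable line of `ρ|_{Γ_{ℚ_w}}`, against N2.  Size M. [cite: Edixhoven1992, Thm. 2.6] -/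
theorem false_of_nonunit_of_ordinary (hN2 : Newform1NonUnitLocallyIrreducible) (hPk : HoledPacket W ℓ f₀)
    (hℓN : ¬ ℓ ∣ N) (ι : PadicAlgCl ℓ ≃+* ℂ) (hnu : Valued.v (ι.symm (cuspCoeff f₀ ℓ)) < 1)
    (v : HeightOneSpectrum (𝓞 ℚ)) (hv : (ℓ : 𝓞 ℚ) ∈ v.asIdeal) (hgood : W.HasGoodReductionAt v)
    (hord : ¬ ((ℓ : ℤ) ∣ W.frobeniusTraceAt v)) : False := by
  sorry

/-- **H5m — non-unit ∧ MULTIPLICATIVE at `ℓ ∤ N` is impossible**: the Tate line (N3m) against N2.  Size M.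
[cite: Edixhoven1992, Thm. 2.6] [cite: DarmonDiamondTaylor1995, Prop. 2.12] -/
theorem false_of_nonunit_of_hasMultiplicativeReductionAt (hN2 : Newform1NonUnitLocallyIrreducible)
    (hN3m : TateFiltrationAtP) (hPk : HoledPacket W ℓ f₀) (hℓN : ¬ ℓ ∣ N) (ι : PadicAlgCl ℓ ≃+* ℂ)
    (hnu : Valued.v (ι.symm (cuspCoeff f₀ ℓ)) < 1) (v : HeightOneSpectrum (𝓞 ℚ))
    (hv : (ℓ : 𝓞 ℚ) ∈ v.asIdeal) (hmult : W.HasMultiplicativeReductionAt v) : False := by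
  sorry

/-- **H6 — non-unit ∧ good SUPERSINGULAR ∧ `ℓ ≥ 5` ⇒ both sides vanish.**  Newform: `a_ℓ(f₀) ∈ ℤ` (the packet
is rational: `σ(f₀)` has the same a.e. packet, strong multiplicity one `level_eq_and_cuspCoeff_eq_of_cuspCoeff_eq_off`,
k2 M1, PROVED; integrality `exists_int_cuspCoeff_integralBasis`), non-unit ⇒ `ℓ ∣ a_ℓ(f₀)`, Deligne N4
`|a_ℓ(f₀)| ≤ 2√ℓ` ⇒ `0` (H6-core); curve: `ℓ ∣ a_ℓ(W)`, Hasse ⇒ `0`.  Size M.  NOT needed at the route's call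
sites (its only `ℓ = 5` site is multiplicative). [cite: Deligne1974, Thm. 8.2] [cite: SilvermanAEC2009, Thm. V.1.1] -/
theorem cuspCoeff_eq_lFunction_of_nonunit_of_supersingular (hN4 : Deligne1974_heckeT_eigenvalue_norm_le)
    (hPk : HoledPacket W ℓ f₀) (hℓN : ¬ ℓ ∣ N) (ι : PadicAlgCl ℓ ≃+* ℂ)
    (hnu : Valued.v (ι.symm (cuspCoeff f₀ ℓ)) < 1) (v : HeightOneSpectrum (𝓞 ℚ))
    (hv : (ℓ : 𝓞 ℚ) ∈ v.asIdeal) (hgood : W.HasGoodReductionAt v) (hss : (ℓ : ℤ) ∣ W.frobeniusTraceAt v)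
    (h5 : 5 ≤ ℓ) : cuspCoeff f₀ ℓ = (W.LFunction ℓ : ℂ) := by
  sorry

end Helpers

/-! ## §3 The residual and the closers -/

section Closers

/-- **R — `FreyThreeSupersingularResidual`: the route's irreducible Eichler–Shimura core, typed.**  For a Frey
curve with `3 ∤ ab(a+b)` (good SUPERSINGULAR at `3`, `a_3(E) = 0` by E1′) and a holed packet newform `f₀` at
`ℓ = 3` with `3 ∤ N`: `a_3(f₀) = 0` (what survives §2 is exactly `a_3(f₀) ≠ ±3`).  Needs the crystalline-trace
comparison for `f₀` at `3` (Saito 1997) or a second realisation prime (k1 J-leaf / k2 CS recut); no local extreme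
decides it (certificate: `37.a1`, `a_3 = -3`, and `E_(1,4)` = `80.b`, `a_3 = 0`, have the same inertia shape
`ψ₂ ⊕ ψ₂³` and the same non-ordinary slope `1/2`). [cite: Saito1997, Thm.] [cite: DiamondShurman2005, Prop. 9.6.4] -/
def FreyThreeSupersingularResidual : Prop :=
  ∀ (a b : ℤ), IsCoprime a b → a * b * (a + b) ≠ 0 → ¬ (3 : ℤ) ∣ a * b * (a + b) →
    ∀ {N : ℕ} [NeZero N] (f₀ : CuspForm (Gamma0 N) 2),
      HoledPacket (freyCurve a b) 3 f₀ → ¬ 3 ∣ N → cuspCoeff f₀ 3 = 0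

/-- **The semistable-regime class at `ℓ`**: `W` semistable at every place over `ℓ`, and good-supersingular at
`ℓ` only if `ℓ ≥ 5`.  Contains call sites I1 with `3 ∣ abc`, I2 (by E4) and I3 (by liftFive G1); excludes exactly
I1 with `3 ∤ abc`. -/
def RegimeClass (W : WeierstrassCurve ℚ) (ℓ : ℕ) : Prop :=
  (∀ v : HeightOneSpectrum (𝓞 ℚ), (ℓ : 𝓞 ℚ) ∈ v.asIdeal →
      W.HasGoodReductionAt v ∨ W.HasMultiplicativeReductionAt v) ∧
    ∀ v : HeightOneSpectrum (𝓞 ℚ), (ℓ : 𝓞 ℚ) ∈ v.asIdeal → W.HasGoodReductionAt v →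
      (ℓ : ℤ) ∣ W.frobeniusTraceAt v → 5 ≤ ℓ

/-- **H7 — the regime closer: `SomeLevelPacketFor W ℓ` on the regime class from {M0, N1, N2, N3o, N3m, N4}.**
Glue: M0 gives the holed packet; `ℓ ∣ N` ⇒ closer 0a; else `Valued.v (ι⁻¹ a_ℓ) ≤ 1` (integrality) splits
unit / non-unit, the place `v ∣ ℓ` is good-ordinary / good-supersingular / multiplicative; H2/H6 ⇒ closer 0b,
H3/H4/H5o/H5m ⇒ `⊥`.  `hM0` is k2's PROVED M0, a binder only because crux-dir companions are not importable.
Size M (pure glue once H2–H6 stand). [cite: DiamondShurman2005, Prop. 9.6.4] -/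
theorem someLevelPacketFor_of_regime (hM0 : ∀ (W : WeierstrassCurve ℚ) [W.IsElliptic] (ℓ : ℕ) [Fact ℓ.Prime],
      W.IsModularGaloisRepTate ℓ → ∃ (N : ℕ) (_ : NeZero N) (f₀ : CuspForm (Gamma0 N) 2), HoledPacket W ℓ f₀)
    (hN1 : Hida2000_thm326_ordinary_unitRoot) (hN2 : Newform1NonUnitLocallyIrreducible)
    (hN3o : OrdinaryEtaleQuotientUnitRoot) (hN3m : TateFiltrationAtP)
    (hN4 : Deligne1974_heckeT_eigenvalue_norm_le) (W : WeierstrassCurve ℚ) [W.IsElliptic] (ℓ : ℕ)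
    [Fact ℓ.Prime] (hW : RegimeClass W ℓ) : SomeLevelPacketFor W ℓ := by
  sorry

/-- **The reshape proposal, typed: S9′ = S9 on the regime class** — from H7 and the gen-6 packet-to-modularity
chain (`hPM`: gen-6 k3 `isModular_of_packet_of_carayol1986_of_saito_of_sign` ∘ G6b, PROVED modulo C_A, Saito@2,
`CarayolSteinbergGamma0`; a binder here only because crux-dir companions are not importable).  PROVED glue. -/
theorem stub_threeImpTwo_on_regimeClass
    (hSLP : ∀ (W : WeierstrassCurve ℚ) [W.IsElliptic] (ℓ : ℕ) [Fact ℓ.Prime], RegimeClass W ℓ →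
      SomeLevelPacketFor W ℓ)
    (hPM : ∀ (W : WeierstrassCurve ℚ) [W.IsElliptic] [NeZero (W.conductorNorm ℤ)] {N : ℕ} [NeZero N]
      (f₀ : CuspForm (Gamma0 N) 2), FullPacket W f₀ → BCDT.IsModular W) :
    ∀ (W : WeierstrassCurve ℚ) [W.IsElliptic] [NeZero (W.conductorNorm ℤ)] (ℓ : ℕ) [Fact ℓ.Prime],
      RegimeClass W ℓ → W.IsModularGaloisRepTate ℓ → BCDT.IsModular W := by
  intro W _ _ ℓ _ hW h
  have h' := hSLP W ℓ hW
  unfold SomeLevelPacketFor at h'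
  obtain ⟨N, hN, f₀, hf⟩ := h' h
  exact hPM W f₀ hf

/-- **S9″ — the residual call site (I1, `3 ∤ abc`)**: R + E1′ fill the hole of the Frey packet at `ℓ = 3`
(closer 0b; good at `3` since `3 ∤ abc ⇒ 3 ∤ N_E`), then `hPM` as above.  Size S glue. -/
theorem isModular_freyCurve_of_residual_of_not_three_dvd
    (hM0 : ∀ (W : WeierstrassCurve ℚ) [W.IsElliptic] (ℓ : ℕ) [Fact ℓ.Prime],
      W.IsModularGaloisRepTate ℓ → ∃ (N : ℕ) (_ : NeZero N) (f₀ : CuspForm (Gamma0 N) 2), HoledPacket W ℓ f₀)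
    (hR : FreyThreeSupersingularResidual)
    (hPM : ∀ (W : WeierstrassCurve ℚ) [W.IsElliptic] [NeZero (W.conductorNorm ℤ)] {N : ℕ} [NeZero N]
      (f₀ : CuspForm (Gamma0 N) 2), FullPacket W f₀ → BCDT.IsModular W)
    {a b : ℤ} (hab : IsCoprime a b) (h0 : a * b * (a + b) ≠ 0) (h3 : ¬ (3 : ℤ) ∣ a * b * (a + b))
    [(freyCurve a b).IsElliptic] [NeZero ((freyCurve a b).conductorNorm ℤ)] [Fact (Nat.Prime 3)]
    (h : (freyCurve a b).IsModularGaloisRepTate 3) : BCDT.IsModular (freyCurve a b) := by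
  sorry

end Closers

end Summit.ABC.ABC.Cruxes.FreyModularity.Sketch.ThreeImpTwoIdeas3g7

end
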